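import Summits.AtomisticToContinuum.BoseEinsteinCondensation.Theorems.BECGroundStateSOSPeriodicIRBoundFsumReduction
import Summits.AtomisticToContinuum.BoseEinsteinCondensation.Theorems.BECGroundStateSOSPeriodicIRBoundReductionIntegrable
import Summits.AtomisticToContinuum.BoseEinsteinCondensation.Theorems.BECSectorPoincareTwoScaleLandauToPeriodicBECModeCounting
import Summits.AtomisticToContinuum.BoseEinsteinCondensation.Theorems.BECThomsonPrincipleGDTransferDefs
import HarnessLib

/-!
# Route `BECGroundStateSOS`, crux `PeriodicIRBound` (stmt-AtomisticToContinuum-3972) —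
# the difficulty floor of the two crux lines, as importable theorems

Both crux lines of `Cruxes/PeriodicIRBound/Lines/` have been driven (line lead seats -0 … c9) to a residual
set of open named inputs:

* `fsum-phase-pencil`: S1 `BackflowBound`, S4′ `CondensatePairingSign`, S5a `CondensateNumberVariance`
  (integrable potentials; `FsumPhasePencil.stub_fsumReduction`, p130612) and S6 `NonIntegrableHalf` (hard cores);
* `linear-ph-floor-wagner`: the pooled sibling items `LandauSectorBound` (stmt-9091) and `EnergyConvexityWindow`
  (stmt-9094) (integrable potentials; `LinearPhFloorWagner.integrableClass_of_pooled`, p121190) and stub 6b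
  `HardCoreWagnerFeynmanBound` (hard cores).

This file records, as kernel-checked compositions of LANDED theorems, the lower bound on what those residual
inputs assert: each residual set implies Bose–Einstein condensation of the periodic near-minimisers in the
thermodynamic box `L_N = (N/ρ)^{1/3}` at every small density, for every repulsive finite-range INTEGRABLE pair
potential — the torus form of the open conjunct `_root_.BoseEinsteinCondensation` restricted to soft potentials
(the route's own mode-counting support `IRModeCounting`, stmt-4246, in the per-potential form
`LandauToPeriodicBEC.periodicBEC_of_irBoundFor` of the sibling route, p99222). The crux itself implies torus BEC
for every admissible potential (`periodicBECFor_of_periodicIRBound`, the route's design X ⇒ BEC). Consequently no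
line for this crux can consist of "provable-now" stubs unless thermodynamic-limit BEC is provable now; the lines
relocate the open problem into named correlation inequalities, they do not lower it (seat c10's line verdict,
`Cruxes/PeriodicIRBound/Lines/*.dead.md`).

References: [LSSY2005] Lieb–Seiringer–Solovej–Yngvason, *The Mathematics of the Bose Gas and its Condensation*
(2005), §1.2 and Ch. 5 (BEC in the thermodynamic limit is open), Thm. 2.2; [KLS1988PRL] Kennedy–Lieb–Shastry,
Phys. Rev. Lett. 61 (1988) 2582 (infrared bound ⇒ condensation by mode counting).
-/

noncomputable section

open MeasureTheory Filter
open scoped ENNReal NNReal BigOperators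

namespace Summit.AtomisticToContinuum.BoseEinsteinCondensation.Cruxes.PeriodicIRBound.DifficultyFloor

open Literature.MathematicalPhysics.QuantumManyBody.BoseGas
open Summit.AtomisticToContinuum.BoseEinsteinCondensation.Theses.BECGroundStateSOS (PeriodicIRBound)
open Summit.AtomisticToContinuum.BoseEinsteinCondensation.Theses.BECSectorPoincareTwoScale
  (LandauSectorBound EnergyConvexityWindow)
open Summit.AtomisticToContinuum.BoseEinsteinCondensation.Theorems.PeriodicIRBound.Negative
  (IRBoundFor periodicIRBound_iff)
open Summit.AtomisticToContinuum.BoseEinsteinCondensation.Theorems.LandauToPeriodicBEC (periodicBEC_of_irBoundFor)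
open Summit.AtomisticToContinuum.BoseEinsteinCondensation.Cruxes.PeriodicIRBound.FsumPhasePencil
  (BackflowBound CondensatePairingSign CondensateNumberVariance irBoundFor_integrable_of_pairingSign)
open Summit.AtomisticToContinuum.BoseEinsteinCondensation.Cruxes.PeriodicIRBound.LinearPhFloorWagner
  (integrableClass_of_pooled)
-- `PeriodicBECFor v` = torus BEC of the `δ`-near-minimisers at every small density, eventually in `N` (the body of
-- `PeriodicBEC` at one potential; landed vocabulary of the sibling crux `GDTransfer`, reused verbatim, not re-declared)
open Summit.AtomisticToContinuum.BoseEinsteinCondensation.Cruxes.GDTransfer.DysonDressedWitness (PeriodicBECFor)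

/-- **The crux implies torus BEC for every admissible potential** (the route's design X ⇒ BEC, per potential:
`Negative.periodicIRBound_iff` + `periodicBEC_of_irBoundFor`). [folklore] -/
theorem periodicBECFor_of_periodicIRBound (hX : PeriodicIRBound) :
    ∀ v : ℝ → ℝ≥0∞, IsRepulsiveFiniteRange v → PeriodicBECFor v :=
  fun v hv => periodicBEC_of_irBoundFor v hv (periodicIRBound_iff.mp hX v hv)

/-- **Difficulty floor of line `fsum-phase-pencil`.** Its three open analytic stubs S1 `BackflowBound`, S4′
`CondensatePairingSign`, S5a `CondensateNumberVariance` together imply torus BEC in the thermodynamic box at every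
small density for EVERY repulsive finite-range integrable pair potential (S2, S3, S5 being landed):
`irBoundFor_integrable_of_pairingSign` (p130612) composed with `periodicBEC_of_irBoundFor` (p99222). [folklore] -/
theorem periodicBECFor_integrable_of_fsumInputs (h1 : BackflowBound) (h4' : CondensatePairingSign)
    (h5a : CondensateNumberVariance) :
    ∀ v : ℝ → ℝ≥0∞, IsRepulsiveFiniteRange v → (∫⁻ x : Space, v ‖x‖) ≠ ⊤ → PeriodicBECFor v :=
  fun v hv hint => periodicBEC_of_irBoundFor v hv (irBoundFor_integrable_of_pairingSign h1 h4' h5a v hv hint)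

/-- **Difficulty floor of line `linear-ph-floor-wagner`.** Its two pooled open inputs `LandauSectorBound`
(stmt-9091) and `EnergyConvexityWindow` (stmt-9094) together imply torus BEC in the thermodynamic box at every
small density for EVERY repulsive finite-range integrable pair potential (all own stubs of the line except 6b
being landed): `integrableClass_of_pooled` (p121190) composed with `periodicBEC_of_irBoundFor` (p99222).
[folklore] -/
theorem periodicBECFor_integrable_of_pooledInputs (h₁ : LandauSectorBound) (h₂ : EnergyConvexityWindow) :
    ∀ v : ℝ → ℝ≥0∞, IsRepulsiveFiniteRange v → (∫⁻ x : Space, v ‖x‖) ≠ ⊤ → PeriodicBECFor v :=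
  fun v hv hint => periodicBEC_of_irBoundFor v hv (integrableClass_of_pooled h₁ h₂ v hv hint)

/-- **Registered by-product sub-goal `stub_difficultyFloor`** of the crux ledger (line lead seat c10): the three
floors in one conjunction — the crux, the `fsum-phase-pencil` residual {S1, S4′, S5a} and the `linear-ph-floor-wagner`
residual {stmt-9091, stmt-9094} each imply torus BEC in the thermodynamic box (`PeriodicBECFor v`) for every
admissible (resp. admissible integrable) pair potential. [folklore] -/
theorem stub_difficultyFloor : (PeriodicIRBound → ∀ v : ℝ → ℝ≥0∞, IsRepulsiveFiniteRange v → PeriodicBECFor v) ∧ (BackflowBound → CondensatePairingSign → CondensateNumberVariance → ∀ v : ℝ → ℝ≥0∞, IsRepulsiveFiniteRange v → (∫⁻ x : Space, v ‖x‖) ≠ ⊤ → PeriodicBECFor v) ∧ (LandauSectorBound → EnergyConvexityWindow → ∀ v : ℝ → ℝ≥0∞, IsRepulsiveFiniteRange v → (∫⁻ x : Space, v ‖x‖) ≠ ⊤ → PeriodicBECFor v) :=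
  ⟨periodicBECFor_of_periodicIRBound, periodicBECFor_integrable_of_fsumInputs,
    periodicBECFor_integrable_of_pooledInputs⟩

end Summit.AtomisticToContinuum.BoseEinsteinCondensation.Cruxes.PeriodicIRBound.DifficultyFloor

end
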